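import Literature.Geometry.Lorentzian.KerrConvergence

/-!
# Route StarvedNecks — crux `NecksCertify`, line `two-cap-focusing-ledger`: seam surgery, clock clauses of `d₂`

Helper file for the registered stub `stub_seamSurgery` (N2): the purely coordinate clauses S7, S8,
S9, S12 of `Seamed` for the seamed decomposition, transported from the `SeamClockRadii` outputs
(thresholds `τ₀' ≤ T`) to the re-clocked backgrounds `B₂ j` (radius unchanged, time `− s j`), and
the threshold bookkeeping `flat-late ⇒ hole-late` at `T ≥ Y` (`seamed₂_clock`, `thresholds₂`);
anchor `stub_seamSurgery_reclock` (registered helper sub-goal).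

Mathlib + `Literature.Geometry.Lorentzian.KerrConvergence`; no definitions, no named facts.
-/

noncomputable section

open scoped Manifold ContDiff Topology ENNReal
open Filter Set Function Topology Literature.Geometry.Lorentzian

namespace Summit.FinalStateConjecture.FinalStateConjecture.Theorems.NecksCertifyTwoCap.Seam

set_option linter.dupNamespace false

/-- Registered helper sub-goal `stub_seamSurgery_reclock` of N2 (anchor of this file): re-clocking
identity `(t − s) + s = t` under a function. [folklore] -/
theorem stub_seamSurgery_reclock : ∀ (R : ℝ → ℝ) (t s : ℝ), R (t - s + s) = R t :=
  fun R t s ↦ by rw [sub_add_cancel]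

/-- Clauses S7, S8, S9, S12 of `Seamed` for the seamed decomposition, from the `SeamClockRadii`
outputs at thresholds `τ₀' ≤ T`, in the re-clocked vocabulary. [folklore] -/
theorem seamed₂_clock {N : ℕ} (Λ : Fin N → lorentzGroup) (c : Fin N → E4) (M a : Fin N → ℝ)
    (τ₀' T : ℝ) (hT1 : τ₀' ≤ T) (s : Fin N → ℝ) (ρ' Rg : Fin N → ℝ → ℝ)
    (hS8 : ∀ j (y : E4), τ₀' ≤ y 0 → (boostedKerrBackground (Λ j) (c j) (M j) (a j)).radius y ≤ ρ' j (y 0) →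
      (boostedKerrBackground (Λ j) (c j) (M j) (a j)).radius y + 2 ≤ Rg j ((boostedKerrBackground (Λ j) (c j) (M j) (a j)).time y - s j + s j))
    (hS9 : ∀ j (y : E4), τ₀' ≤ (boostedKerrBackground (Λ j) (c j) (M j) (a j)).time y - s j → (boostedKerrBackground (Λ j) (c j) (M j) (a j)).radius y ≤ Rg j ((boostedKerrBackground (Λ j) (c j) (M j) (a j)).time y - s j + s j) + 2 →
      (boostedKerrBackground (Λ j) (c j) (M j) (a j)).time y - s j ≤ y 0)
    (hS12 : ∀ j j' (y : E4), j ≠ j' → (τ₀' ≤ y 0 ∨ τ₀' ≤ (boostedKerrBackground (Λ j) (c j) (M j) (a j)).time y - s j) →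
      (boostedKerrBackground (Λ j) (c j) (M j) (a j)).radius y ≤ Rg j ((boostedKerrBackground (Λ j) (c j) (M j) (a j)).time y - s j + s j) + 1 →
      Rg j' ((boostedKerrBackground (Λ j') (c j') (M j') (a j')).time y - s j' + s j') + 1 < (boostedKerrBackground (Λ j') (c j') (M j') (a j')).radius y)
    (B₂ : Fin N → ModelBackground) (htime : ∀ j y, (B₂ j).time y = (boostedKerrBackground (Λ j) (c j) (M j) (a j)).time y - s j)
    (hrad : ∀ j y, (B₂ j).radius y = (boostedKerrBackground (Λ j) (c j) (M j) (a j)).radius y)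
    (U₂ : TopologicalSpace.Opens E4) (hUmem : ∀ y : E4, y ∈ U₂ → ∀ j, ρ' j (y 0) < (boostedKerrBackground (Λ j) (c j) (M j) (a j)).radius y) :
    (∀ y : U₂, T ≤ y.1 0 → ∀ j, ρ' j (y.1 0) < (B₂ j).radius y.1) ∧
    (∀ j (y : E4), T ≤ y 0 → (B₂ j).radius y ≤ ρ' j (y 0) →
      (B₂ j).radius y + 2 ≤ Rg j ((B₂ j).time y + s j)) ∧
    (∀ j (y : E4), T ≤ (B₂ j).time y → (B₂ j).radius y ≤ Rg j ((B₂ j).time y + s j) + 2 →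
      (B₂ j).time y ≤ y 0) ∧
    (∀ j j' (y : E4), j ≠ j' → (T ≤ y 0 ∨ T ≤ (B₂ j).time y) →
      (B₂ j).radius y ≤ Rg j ((B₂ j).time y + s j) + 1 →
      Rg j' ((B₂ j').time y + s j') + 1 < (B₂ j').radius y) := by
  refine ⟨fun y _ j ↦ by rw [hrad]; exact hUmem y.1 y.2 j, ?_, ?_, ?_⟩
  · intro j y hy hr
    rw [hrad, htime] at *
    exact hS8 j y (hT1.trans hy) hr
  · intro j y hy hr
    rw [hrad, htime] at *
    exact hS9 j y (hT1.trans hy) hr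
  · intro j j' y hjj' hy hr
    have hr' : (boostedKerrBackground (Λ j) (c j) (M j) (a j)).radius y ≤ Rg j ((boostedKerrBackground (Λ j) (c j) (M j) (a j)).time y - s j + s j) + 1 := by
      have h := hr; rwa [hrad, htime] at h
    have hy' : τ₀' ≤ y 0 ∨ τ₀' ≤ (boostedKerrBackground (Λ j) (c j) (M j) (a j)).time y - s j := by
      rcases hy with h | h
      · left; linarith
      · right; rw [htime] at h; linarith
    have := hS12 j j' y hjj' hy' hr'
    show Rg j' ((B₂ j').time y + s j') + 1 < (B₂ j').radius y
    rw [hrad, htime]; exact this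

/-- Threshold bookkeeping for the seam: at flat times `≥ T ≥ Y` (`Y` from the converse clock
comparison of `SeamClockRadii`) tube points are hole-late, `t − s ≥ τ₁ + 3`. [folklore] -/
theorem thresholds₂ {N : ℕ} (Λ : Fin N → lorentzGroup) (c : Fin N → E4) (M a : Fin N → ℝ)
    (τ₁ Y T : ℝ) (hT4 : Y ≤ T) (s : Fin N → ℝ) (Rg : Fin N → ℝ → ℝ)
    (hY : ∀ j (y : E4), Y ≤ y 0 → (boostedKerrBackground (Λ j) (c j) (M j) (a j)).radius y ≤ Rg j ((boostedKerrBackground (Λ j) (c j) (M j) (a j)).time y) + 2 → τ₁ + 3 ≤ (boostedKerrBackground (Λ j) (c j) (M j) (a j)).time y - s j) :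
    (∀ j (y : E4), T < y 0 → (boostedKerrBackground (Λ j) (c j) (M j) (a j)).radius y ≤ Rg j ((boostedKerrBackground (Λ j) (c j) (M j) (a j)).time y) + 2 → τ₁ + 3 ≤ (boostedKerrBackground (Λ j) (c j) (M j) (a j)).time y - s j) ∧
    (∀ j (y : E4), T ≤ y 0 → (boostedKerrBackground (Λ j) (c j) (M j) (a j)).radius y ≤ Rg j ((boostedKerrBackground (Λ j) (c j) (M j) (a j)).time y) + 2 → τ₁ + 3 ≤ (boostedKerrBackground (Λ j) (c j) (M j) (a j)).time y - s j) ∧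
    (∀ T' : ℝ, T ≤ T' → ∀ j (y : E4), T' < y 0 → (boostedKerrBackground (Λ j) (c j) (M j) (a j)).radius y ≤ Rg j ((boostedKerrBackground (Λ j) (c j) (M j) (a j)).time y) + 2 →
      τ₁ + 5 / 2 + s j < (boostedKerrBackground (Λ j) (c j) (M j) (a j)).time y) :=
  ⟨fun j y h1 h2 ↦ hY j y (by linarith) h2, fun j y h1 h2 ↦ hY j y (by linarith) h2,
    fun T' hT' j y h1 h2 ↦ by have := hY j y (by linarith) h2; linarith⟩

end Summit.FinalStateConjecture.FinalStateConjecture.Theorems.NecksCertifyTwoCap.Seam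

end
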